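import Summits.AtomisticToContinuum.Crystallization.Theorems.ExcessDecayLiouvilleDyadicFarMass

/-!
# Route `ExcessDecayLiouville`: masses from pointwise envelopes (nonlinear half, XVII)

Harmonic-replacement architecture for item `ExcessDecay` (stmt-AtomisticToContinuum-9334), nonlinear half.
The excess-decay induction carries POINTWISE envelopes of the fields; the linear and nonlinear estimates
consume MASSES.  The conversions:
* `mass_le_of_pointwise` : `𝐌[f, c₀, X] ≤ 32 X³ S²` if `‖f x‖ ≤ S` at the sites of `B_X(c₀)` (`X ≥ 1`);
* `farMass_le_of_masses` : from dyadic mass bounds `𝐌[f, 2^{n+1}Y] ≤ P (2^{n+1}Y)⁶` up to the radius `R_far`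
  and `𝐌[f, ·] ≤ M_tot` beyond, `𝐉[f, c₀, Y] ≤ 128 P / Y² + 256 M_tot / (R_far⁷ Y)` (via `farMass_le_dyadic`).
All `[folklore]`; helper lemmas, nothing here closes an item.
-/

noncomputable section

namespace Summit.AtomisticToContinuum.Crystallization.Theorems.ExcessDecayLiouville

open scoped BigOperators Topology Classical
open Literature.MathematicalPhysics.StatisticalMechanics
open Summit.AtomisticToContinuum.Crystallization.Theorems.PhononStabilityNegative

set_option quotPrecheck false in
-- Local notation: ball indicator.
local notation "𝟙ᵇ[" x ", " c ", " R "]" => (if dist (x : EuclideanSpace ℝ (Fin 3)) c ≤ R then (1 : ℝ) else 0)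

section

variable {t : Fin 2 → (EuclideanSpace ℝ (Fin 3))} {A : (EuclideanSpace ℝ (Fin 3)) →L[ℝ] (EuclideanSpace ℝ (Fin 3))}
  {c₀ : EuclideanSpace ℝ (Fin 3)}

set_option quotPrecheck false in
-- local mass on the ball of radius `X` about `c₀`
local notation "𝐌[" f ", " X "]" =>
  tsum (fun p : Sites₀ t A => ‖f (p : EuclideanSpace ℝ (Fin 3))‖ ^ 2 * 𝟙ᵇ[p, c₀, X])
set_option quotPrecheck false in
-- weighted far mass with floor `Y` about `c₀`
local notation "𝐉[" f ", " Y "]" =>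
  tsum (fun q : Sites₀ t A => ‖f (q : EuclideanSpace ℝ (Fin 3))‖ ^ 2 * (max (dist (q : EuclideanSpace ℝ (Fin 3)) c₀) Y)⁻¹ ^ 8)

/-- **Mass from a pointwise envelope**: `𝐌[f, X] ≤ 32 X³ S²` if `‖f x‖ ≤ S` at the sites of `B_X(c₀)`, `X ≥ 1`.
[folklore] -/
theorem mass_le_of_pointwise (hA : Adm₀ A) (hI : Inner₀ t A) (f : (EuclideanSpace ℝ (Fin 3)) → (EuclideanSpace ℝ (Fin 3)))
    {X S : ℝ} (hX : 1 ≤ X) (hf : ∀ x ∈ Sites₀ t A, dist x c₀ ≤ X → ‖f x‖ ≤ S) :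
    𝐌[f, X] ≤ 32 * X ^ 3 * S ^ 2 := by
  rw [tsum_indicator_eq_sum hA hI (fun x => ‖f x‖ ^ 2) c₀ X]
  have hmem : ∀ x ∈ (finite_sites_dist_le hA hI c₀ X).toFinset, x ∈ Sites₀ t A ∧ dist x c₀ ≤ X := fun x hx => by
    have h := (Set.Finite.mem_toFinset (finite_sites_dist_le hA hI c₀ X)).1 hx
    exact h
  calc ∑ x ∈ (finite_sites_dist_le hA hI c₀ X).toFinset, ‖f x‖ ^ 2
      ≤ ∑ x ∈ (finite_sites_dist_le hA hI c₀ X).toFinset, S ^ 2 :=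
        Finset.sum_le_sum fun x hx => pow_le_pow_left₀ (norm_nonneg _) (hf x (hmem x hx).1 (hmem x hx).2) 2
    _ = (finite_sites_dist_le hA hI c₀ X).toFinset.card * S ^ 2 := by rw [Finset.sum_const, nsmul_eq_mul]
    _ ≤ 32 * X ^ 3 * S ^ 2 := mul_le_mul_of_nonneg_right (card_ball_sites_le hA hI c₀ hX _ hmem) (sq_nonneg _)

/-- **Weighted far mass from dyadic masses** (see the module docstring). [folklore] -/
theorem farMass_le_of_masses (f : (EuclideanSpace ℝ (Fin 3)) → (EuclideanSpace ℝ (Fin 3)))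
    (hf : (Function.support f).Finite) {Y Rfar P Mtot : ℝ} (hY : 0 < Y) (hR : 0 < Rfar) (hP : 0 ≤ P) (hM : 0 ≤ Mtot)
    (K : ℕ) (hK : ∀ x, f x ≠ 0 → dist x c₀ ≤ 2 ^ (K + 1) * Y)
    (hnear : ∀ n : ℕ, 2 ^ (n + 1) * Y ≤ Rfar → 𝐌[f, 2 ^ (n + 1) * Y] ≤ P * (2 ^ (n + 1) * Y) ^ 6)
    (hfar : ∀ n : ℕ, 𝐌[f, 2 ^ (n + 1) * Y] ≤ Mtot) :
    𝐉[f, Y] ≤ 128 * P / Y ^ 2 + 256 * Mtot / (Rfar ^ 7 * Y) := by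
  -- dyadic decomposition
  have hg0 : ∀ x, 0 ≤ (fun x => ‖f x‖ ^ 2) x := fun x => by positivity
  have hgfin : (Function.support (fun x => ‖f x‖ ^ 2)).Finite := by
    refine hf.subset fun x hx => ?_
    simp only [Function.mem_support, ne_eq] at hx ⊢
    intro h0; apply hx; rw [h0, norm_zero]; ring
  have hK' : ∀ x, (fun x => ‖f x‖ ^ 2) x ≠ 0 → dist x c₀ ≤ 2 ^ (K + 1) * Y := by
    intro x hx; apply hK x; intro h0; apply hx; simp only []; rw [h0, norm_zero]; ring
  have hdy := farMass_le_dyadic (t := t) (A := A) (fun x => ‖f x‖ ^ 2) hg0 hgfin c₀ hY K hK'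
  refine hdy.trans ?_
  -- each dyadic term
  have hterm : ∀ n : ℕ, ((2 : ℝ) ^ n * Y)⁻¹ ^ 8 * 𝐌[f, 2 ^ (n + 1) * Y] ≤
      64 * P / Y ^ 2 * ((2 : ℝ) ^ n)⁻¹ + 128 * Mtot / (Rfar ^ 7 * Y) * ((2 : ℝ) ^ n)⁻¹ := by
    intro n
    have h2n : 0 < (2 : ℝ) ^ n := by positivity
    have hi2 : ((2 : ℝ) ^ n)⁻¹ ≤ 1 := inv_le_one_of_one_le₀ (one_le_pow₀ (by norm_num))
    have hw0 : 0 ≤ ((2 : ℝ) ^ n * Y)⁻¹ ^ 8 := by positivity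
    have hMn : 0 ≤ 𝐌[f, 2 ^ (n + 1) * Y] := tsum_nonneg fun p => by positivity
    have ht1 : 0 ≤ 64 * P / Y ^ 2 * ((2 : ℝ) ^ n)⁻¹ := by positivity
    have ht2 : 0 ≤ 128 * Mtot / (Rfar ^ 7 * Y) * ((2 : ℝ) ^ n)⁻¹ := by positivity
    by_cases hn : 2 ^ (n + 1) * Y ≤ Rfar
    · -- near: (2ⁿY)⁻⁸ P (2^{n+1}Y)⁶ = 64 P / Y² / 4ⁿ ≤ 64 P / Y² / 2ⁿ
      have h1 : ((2 : ℝ) ^ n * Y)⁻¹ ^ 8 * (P * (2 ^ (n + 1) * Y) ^ 6) = 64 * P / Y ^ 2 * (((2 : ℝ) ^ n)⁻¹ * ((2 : ℝ) ^ n)⁻¹) := by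
        field_simp
        ring
      have h2 : ((2 : ℝ) ^ n)⁻¹ * ((2 : ℝ) ^ n)⁻¹ ≤ ((2 : ℝ) ^ n)⁻¹ := mul_le_of_le_one_right (by positivity) hi2
      calc _ ≤ ((2 : ℝ) ^ n * Y)⁻¹ ^ 8 * (P * (2 ^ (n + 1) * Y) ^ 6) := mul_le_mul_of_nonneg_left (hnear n hn) hw0
        _ = 64 * P / Y ^ 2 * (((2 : ℝ) ^ n)⁻¹ * ((2 : ℝ) ^ n)⁻¹) := h1
        _ ≤ 64 * P / Y ^ 2 * ((2 : ℝ) ^ n)⁻¹ := mul_le_mul_of_nonneg_left h2 (by positivity)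
        _ ≤ _ := le_add_of_nonneg_right ht2
    · -- far: (2ⁿY)⁻⁸ ≤ (2ⁿY)⁻⁸ (2^{n+1}Y/R)⁷ = 128 / (R⁷ Y 2ⁿ)
      have hn' : Rfar < 2 ^ (n + 1) * Y := lt_of_not_ge hn
      have hratio : 1 ≤ 2 ^ (n + 1) * Y / Rfar := by rw [le_div_iff₀ hR, one_mul]; exact hn'.le
      have h1 : ((2 : ℝ) ^ n * Y)⁻¹ ^ 8 ≤ ((2 : ℝ) ^ n * Y)⁻¹ ^ 8 * (2 ^ (n + 1) * Y / Rfar) ^ 7 :=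
        le_mul_of_one_le_right hw0 (one_le_pow₀ hratio)
      have h2 : ((2 : ℝ) ^ n * Y)⁻¹ ^ 8 * (2 ^ (n + 1) * Y / Rfar) ^ 7 = 128 / (Rfar ^ 7 * Y) * ((2 : ℝ) ^ n)⁻¹ := by
        field_simp
        ring
      calc _ ≤ ((2 : ℝ) ^ n * Y)⁻¹ ^ 8 * Mtot := mul_le_mul_of_nonneg_left (hfar n) hw0
        _ ≤ ((2 : ℝ) ^ n * Y)⁻¹ ^ 8 * (2 ^ (n + 1) * Y / Rfar) ^ 7 * Mtot := mul_le_mul_of_nonneg_right h1 hM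
        _ = 128 * Mtot / (Rfar ^ 7 * Y) * ((2 : ℝ) ^ n)⁻¹ := by rw [h2]; ring
        _ ≤ _ := le_add_of_nonneg_left ht1
  have hgeom : ∑ n ∈ Finset.range (K + 1), ((2 : ℝ) ^ n)⁻¹ ≤ 2 := by
    have : ∑ n ∈ Finset.range (K + 1), ((2 : ℝ) ^ n)⁻¹ = ∑ n ∈ Finset.range (K + 1), (1 / 2 : ℝ) ^ n :=
      Finset.sum_congr rfl fun n _ => by rw [one_div, inv_pow]
    rw [this]; exact sum_geometric_two_le _
  calc ∑ n ∈ Finset.range (K + 1), ((2 : ℝ) ^ n * Y)⁻¹ ^ 8 * 𝐌[f, 2 ^ (n + 1) * Y]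
      ≤ ∑ n ∈ Finset.range (K + 1), (64 * P / Y ^ 2 * ((2 : ℝ) ^ n)⁻¹ + 128 * Mtot / (Rfar ^ 7 * Y) * ((2 : ℝ) ^ n)⁻¹) :=
        Finset.sum_le_sum fun n _ => hterm n
    _ = (64 * P / Y ^ 2 + 128 * Mtot / (Rfar ^ 7 * Y)) * ∑ n ∈ Finset.range (K + 1), ((2 : ℝ) ^ n)⁻¹ := by
        rw [Finset.mul_sum]; refine Finset.sum_congr rfl fun n _ => by ring
    _ ≤ (64 * P / Y ^ 2 + 128 * Mtot / (Rfar ^ 7 * Y)) * 2 := mul_le_mul_of_nonneg_left hgeom (by positivity)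
    _ = 128 * P / Y ^ 2 + 256 * Mtot / (Rfar ^ 7 * Y) := by ring

end

end Summit.AtomisticToContinuum.Crystallization.Theorems.ExcessDecayLiouville

end
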